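import Summits.AtomisticToContinuum.FouriersLaw.Theorems.HiddenChargeMazurNoOddChargeOrthogonality

/-!
# No odd small-range charges for the pinned anharmonic chain — Gibbs-measure bounds

Support file for item `stmt-AtomisticToContinuum-13514` (`HiddenChargeMazur.NoOddChargeSmallRange`),
analytic half: `N`-uniform statics of the Gibbs weight `e^{-H/T}` of `pinnedChain ω₂ lam β γ`.

Under the Gibbs probability measure: `E[q_i^{16}] ≤ 585T⁴N/lam⁴`, `E[p_i⁸] ≤ 105T⁴`,
`E[q_i⁸] ≤ √(585T⁴N/lam⁴)`, `E[H2²] ≤ A(1 + 2√(585T⁴N/lam⁴) + 210T⁴)`, `E[j_k²] ≤ N K₀`, the correlation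
bound `|E[j_k H2]| ≤ √(N K₀ B_N)` and `|E[J_N · H2(z_a,z_b)]| ≤ 4√(N K₀ B_N)` (only touching bonds count).
-/

noncomputable section

open MeasureTheory
open scoped BigOperators
open Literature.MathematicalPhysics.KineticTheory.HeatConduction
open Summit.AtomisticToContinuum.FouriersLaw.Theorems.SubdiffusiveBondHeat
open Summit.AtomisticToContinuum.FouriersLaw.Theorems.LightConeBondHeat

namespace Summit.AtomisticToContinuum.FouriersLaw.Theorems.NoOddCharge

variable {N : ℕ}

section Pinned

variable {ω₂ lam β : ℝ}

/-! ### Expectations under the Gibbs probability measure -/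

/-- Integrals against the Gibbs measure: `∫ f dμ_T ≤ B` as soon as `∫ f e^{-H/T} ≤ B ∫ e^{-H/T}`. [folklore] -/
theorem pinnedChain_integral_gibbsMeasure_le_of (hω : 0 < ω₂) (hl : 0 ≤ lam) (hβ : 0 ≤ β) (γ : ℝ) (N : ℕ)
    {T : ℝ} (hT : 0 < T) {f : PhaseSpace N → ℝ} {B : ℝ}
    (h : ∫ x, f x * (pinnedChain ω₂ lam β γ).gibbsDensity N T x ≤
      B * ∫ x, (pinnedChain ω₂ lam β γ).gibbsDensity N T x) :
    ∫ x, f x ∂((pinnedChain ω₂ lam β γ).gibbsMeasure N T) ≤ B := by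
  have hZ : 0 < ∫ x, (pinnedChain ω₂ lam β γ).gibbsDensity N T x :=
    integral_exp_pos (pinnedChain_integrable_gibbsDensity hω hl hβ γ N hT)
  rw [(pinnedChain ω₂ lam β γ).integral_gibbsMeasure, inv_mul_le_iff₀ hZ]
  linarith [mul_comm B (∫ x, (pinnedChain ω₂ lam β γ).gibbsDensity N T x)]

/-- `E_μ[q_i^{16}] ≤ 585 T⁴ N / lam⁴`. [folklore] -/
theorem pinnedChain_gibbs_position_pow_sixteen_le (hω : 0 < ω₂) (hl : 0 < lam) (hβ : 0 ≤ β) (γ : ℝ) (N : ℕ)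
    {T : ℝ} (hT : 0 < T) (i : Fin N) :
    ∫ x, x.1 i ^ 16 ∂((pinnedChain ω₂ lam β γ).gibbsMeasure N T) ≤ 585 * T ^ 4 / lam ^ 4 * N := by
  refine pinnedChain_integral_gibbsMeasure_le_of hω hl.le hβ γ N hT ?_
  have hsum := pinnedChain_sum_integral_position_pow_sixteen_le hω hl hβ γ N hT
  have hsingle : ∫ x, x.1 i ^ 16 * (pinnedChain ω₂ lam β γ).gibbsDensity N T x ≤
      ∑ j : Fin N, ∫ x, x.1 j ^ 16 * (pinnedChain ω₂ lam β γ).gibbsDensity N T x :=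
    Finset.single_le_sum (f := fun j => ∫ x, x.1 j ^ 16 * (pinnedChain ω₂ lam β γ).gibbsDensity N T x)
      (fun j _ => integral_nonneg fun x => mul_nonneg (by positivity)
        ((pinnedChain ω₂ lam β γ).gibbsDensity_pos N T x).le) (Finset.mem_univ i)
  linarith

/-- `E_μ[p_i⁸] ≤ 105 T⁴` (in fact `=`). [folklore] -/
theorem pinnedChain_gibbs_momentum_pow_eight_le (hω : 0 < ω₂) (hl : 0 ≤ lam) (hβ : 0 ≤ β) (γ : ℝ) (N : ℕ)
    {T : ℝ} (hT : 0 < T) (i : Fin N) :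
    ∫ x, x.2 i ^ 8 ∂((pinnedChain ω₂ lam β γ).gibbsMeasure N T) ≤ 105 * T ^ 4 := by
  refine pinnedChain_integral_gibbsMeasure_le_of hω hl hβ γ N hT (le_of_eq ?_)
  have h := fun k => pinnedChain_integral_momentum_pow_add_two' hω hl hβ γ N hT i k
  have h6 := h 6; have h4 := h 4; have h2 := h 2; have h0 := h 0
  norm_num at h6 h4 h2 h0
  rw [h6, h4, h2, h0]
  ring

/-- `E_μ[q_i⁸] ≤ √(585 T⁴ N / lam⁴)` (Cauchy–Schwarz against `1`). [folklore] -/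
theorem pinnedChain_gibbs_position_pow_eight_le (hω : 0 < ω₂) (hl : 0 < lam) (hβ : 0 ≤ β) (γ : ℝ) (N : ℕ)
    {T : ℝ} (hT : 0 < T) (i : Fin N) :
    ∫ x, x.1 i ^ 8 ∂((pinnedChain ω₂ lam β γ).gibbsMeasure N T) ≤ Real.sqrt (585 * T ^ 4 / lam ^ 4 * N) := by
  set μ := (pinnedChain ω₂ lam β γ).gibbsMeasure N T with hμ
  haveI := pinnedChain_isProbabilityMeasure_gibbsMeasure hω hl.le hβ γ N hT
  have hI : ∀ n : ℕ, Integrable (fun x : PhaseSpace N => x.1 i ^ n) μ := fun n =>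
    (pinnedChain ω₂ lam β γ).integrable_gibbsMeasure
      (pinnedChain_integrable_position_pow_mul_gibbsDensity' hω hl hβ γ N hT i n)
  have hcs := sq_integral_mul_le μ (f := fun x => x.1 i ^ 8) (g := fun _ => (1:ℝ))
    ((hI 16).congr (Filter.Eventually.of_forall fun x => by simp only; ring)) (by simp)
    ((hI 8).congr (Filter.Eventually.of_forall fun x => by simp))
  simp only [mul_one, one_pow, integral_const, smul_eq_mul, Measure.real, measure_univ,
    ENNReal.toReal_one] at hcs
  have h16 := pinnedChain_gibbs_position_pow_sixteen_le hω hl hβ γ N hT i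
  have h16' : ∫ x, (x.1 i ^ 8) ^ 2 ∂μ ≤ 585 * T ^ 4 / lam ^ 4 * N := by
    refine le_trans (le_of_eq ?_) h16
    exact integral_congr_ae (Filter.Eventually.of_forall fun x => by simp only; ring)
  apply Real.le_sqrt_of_sq_le
  linarith

/-- **Second moment of a boundary observable**:
`E_μ[H2(z_a,z_b)²] ≤ A (1 + 2√(585 T⁴N/lam⁴) + 210 T⁴)`. [folklore] -/
theorem pinnedChain_gibbs_twoSite_sq_le (hω : 0 < ω₂) (hl : 0 < lam) (hβ : 0 ≤ β) (γ : ℝ) (N : ℕ)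
    {T : ℝ} (hT : 0 < T) {H2 : (Fin 4 → ℝ) → ℝ} (hHc : Continuous H2) {A : ℝ} (hA : 0 ≤ A)
    (hHb : ∀ u, (H2 u) ^ 2 ≤ A * (1 + u 0 ^ 8 + u 1 ^ 8 + u 2 ^ 8 + u 3 ^ 8)) (a b : Fin N) :
    ∫ z, (H2 ![z.1 a, z.2 a, z.1 b, z.2 b]) ^ 2 ∂((pinnedChain ω₂ lam β γ).gibbsMeasure N T) ≤
      A * (1 + 2 * Real.sqrt (585 * T ^ 4 / lam ^ 4 * N) + 210 * T ^ 4) := by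
  set P := pinnedChain ω₂ lam β γ with hP
  set μ := P.gibbsMeasure N T with hμ
  haveI := pinnedChain_isProbabilityMeasure_gibbsMeasure hω hl.le hβ γ N hT
  have hIq : ∀ (i : Fin N) (n : ℕ), Integrable (fun x : PhaseSpace N => x.1 i ^ n) μ := fun i n =>
    P.integrable_gibbsMeasure (pinnedChain_integrable_position_pow_mul_gibbsDensity' hω hl hβ γ N hT i n)
  have hIp : ∀ (i : Fin N) (n : ℕ), Integrable (fun x : PhaseSpace N => x.2 i ^ n) μ := fun i n =>
    P.integrable_gibbsMeasure (pinnedChain_integrable_momentum_pow_mul_gibbsDensity' hω hl.le hβ γ N hT i n)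
  have hIh : Integrable (fun z : PhaseSpace N => (H2 ![z.1 a, z.2 a, z.1 b, z.2 b]) ^ 2) μ := by
    refine P.integrable_gibbsMeasure (pinnedChain_integrable_mul_gibbsDensity_of_le_pow hω hl.le hβ γ N hT 16
      ((continuous_twoSite hHc a b).pow 2) (C := A * (1 + 2 * (1 + 4 / lam) ^ 8 + 2 * 4 ^ 8)) fun z => ?_)
    rw [abs_of_nonneg (sq_nonneg _)]
    exact pinnedChain_twoSite_sq_le hω.le hl hβ γ N hA hHb a b z
  have hmaj : Integrable (fun z : PhaseSpace N => A * (1 + z.1 a ^ 8 + z.2 a ^ 8 + z.1 b ^ 8 + z.2 b ^ 8)) μ :=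
    (((((integrable_const 1).add (hIq a 8)).add (hIp a 8)).add (hIq b 8)).add (hIp b 8)).const_mul A
  calc ∫ z, (H2 ![z.1 a, z.2 a, z.1 b, z.2 b]) ^ 2 ∂μ
      ≤ ∫ z, A * (1 + z.1 a ^ 8 + z.2 a ^ 8 + z.1 b ^ 8 + z.2 b ^ 8) ∂μ := by
        refine integral_mono hIh hmaj fun z => ?_
        have := hHb ![z.1 a, z.2 a, z.1 b, z.2 b]
        simpa using this
    _ = A * (1 + ∫ z, z.1 a ^ 8 ∂μ + ∫ z, z.2 a ^ 8 ∂μ + ∫ z, z.1 b ^ 8 ∂μ + ∫ z, z.2 b ^ 8 ∂μ) := by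
        rw [integral_const_mul, integral_add, integral_add, integral_add, integral_add]
        · simp
        · exact integrable_const 1
        · exact hIq a 8
        · exact (integrable_const 1).add (hIq a 8)
        · exact hIp a 8
        · exact ((integrable_const 1).add (hIq a 8)).add (hIp a 8)
        · exact hIq b 8
        · exact (((integrable_const 1).add (hIq a 8)).add (hIp a 8)).add (hIq b 8)
        · exact hIp b 8
    _ ≤ A * (1 + 2 * Real.sqrt (585 * T ^ 4 / lam ^ 4 * N) + 210 * T ^ 4) := by
        refine mul_le_mul_of_nonneg_left ?_ hA
        have h1 := pinnedChain_gibbs_position_pow_eight_le hω hl hβ γ N hT a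
        have h2 := pinnedChain_gibbs_position_pow_eight_le hω hl hβ γ N hT b
        have h3 := pinnedChain_gibbs_momentum_pow_eight_le hω hl.le hβ γ N hT a
        have h4 := pinnedChain_gibbs_momentum_pow_eight_le hω hl.le hβ γ N hT b
        linarith

/-- **Second moment of a bond current**: `E_μ[j_k²] ≤ N (2T² + 384 β²T³/(lam ω₂))`. [folklore] -/
theorem pinnedChain_gibbs_sq_bondCurrent_le (hω : 0 < ω₂) (hl : 0 < lam) (hβ : 0 < β) (γ : ℝ) (N : ℕ)
    {T : ℝ} (hT : 0 < T) (k : Fin N) :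
    ∫ z, ((pinnedChain ω₂ lam β γ).bondCurrent N k z) ^ 2 ∂((pinnedChain ω₂ lam β γ).gibbsMeasure N T) ≤
      N * (2 * T ^ 2 + 384 * β ^ 2 * T ^ 3 / (lam * ω₂)) := by
  set P := pinnedChain ω₂ lam β γ with hP
  refine pinnedChain_integral_gibbsMeasure_le_of hω hl.le hβ.le γ N hT ?_
  have htot := pinnedChain_sum_integral_sq_bondCurrent_le hω hl hβ γ N hT
  rw [sum_sum_bond_eq N (fun k' _ => ∫ x, (P.bondCurrent N k' x) ^ 2 * P.gibbsDensity N T x)] at htot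
  by_cases hk : k.val + 1 < N
  · have hsingle : ∫ x, (P.bondCurrent N k x) ^ 2 * P.gibbsDensity N T x ≤
        ∑ k' : Fin N, (if h : k'.val + 1 < N then ∫ x, (P.bondCurrent N k' x) ^ 2 * P.gibbsDensity N T x else 0) := by
      have := Finset.single_le_sum
        (f := fun k' : Fin N => if h : k'.val + 1 < N then ∫ x, (P.bondCurrent N k' x) ^ 2 * P.gibbsDensity N T x else 0)
        (fun k' _ => by
          split_ifs
          · exact integral_nonneg fun x => mul_nonneg (sq_nonneg _) (P.gibbsDensity_pos N T x).le
          · exact le_rfl) (Finset.mem_univ k)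
      simpa [hk] using this
    calc ∫ x, (P.bondCurrent N k x) ^ 2 * P.gibbsDensity N T x ≤ _ := hsingle
      _ ≤ N * (∫ x, P.gibbsDensity N T x) * (2 * T ^ 2 + 384 * β ^ 2 * T ^ 3 / (lam * ω₂)) := htot
      _ = _ := by ring
  · have hj : ∀ z, P.bondCurrent N k z = 0 := by
      intro z
      unfold OscillatorChain.bondCurrent
      refine Finset.sum_eq_zero fun j _ => ?_
      rw [if_neg]
      intro hv
      exact hk (hv ▸ j.isLt)
    simp only [hj]
    have hZ : 0 ≤ ∫ x, P.gibbsDensity N T x := integral_nonneg fun x => (P.gibbsDensity_pos N T x).le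
    simp only [ne_eq, OfNat.ofNat_ne_zero, not_false_eq_true, zero_pow, zero_mul, integral_zero]
    positivity

/-- **Correlation bound** `|E_μ[j_k · H2(z_a,z_b)]| ≤ √(N K₀ · B_N)` with `K₀ = 2T² + 384β²T³/(lam ω₂)` and
`B_N = A(1 + 2√(585T⁴N/lam⁴) + 210T⁴)` (Cauchy–Schwarz). [folklore] -/
theorem pinnedChain_gibbs_abs_bondCurrent_mul_twoSite_le (hω : 0 < ω₂) (hl : 0 < lam) (hβ : 0 < β) (γ : ℝ)
    (N : ℕ) {T : ℝ} (hT : 0 < T) {H2 : (Fin 4 → ℝ) → ℝ} (hHc : Continuous H2) {A : ℝ} (hA : 0 ≤ A)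
    (hHb : ∀ u, (H2 u) ^ 2 ≤ A * (1 + u 0 ^ 8 + u 1 ^ 8 + u 2 ^ 8 + u 3 ^ 8)) (a b k : Fin N) :
    |∫ z, (pinnedChain ω₂ lam β γ).bondCurrent N k z * H2 ![z.1 a, z.2 a, z.1 b, z.2 b]
        ∂((pinnedChain ω₂ lam β γ).gibbsMeasure N T)| ≤
      Real.sqrt (N * (2 * T ^ 2 + 384 * β ^ 2 * T ^ 3 / (lam * ω₂)) *
        (A * (1 + 2 * Real.sqrt (585 * T ^ 4 / lam ^ 4 * N) + 210 * T ^ 4))) := by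
  set P := pinnedChain ω₂ lam β γ with hP
  set μ := P.gibbsMeasure N T with hμ
  set Kh : ℝ := Real.sqrt (A * (1 + 2 * (1 + 4 / lam) ^ 8 + 2 * 4 ^ 8)) with hKh
  have hjle : ∀ z, |P.bondCurrent N k z| ≤ N * ((3 + β) / 2) * (1 + P.hamiltonian N z) ^ 2 := by
    intro z
    have := pinnedChain_abs_bondCurrent_le hω.le hl.le hβ.le γ N k z
    linarith
  have hjc : Continuous (P.bondCurrent N k) := pinnedChain_continuous_bondCurrent ω₂ lam β γ N k
  have hhc := continuous_twoSite (N := N) hHc a b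
  have hI2j : Integrable (fun z => (P.bondCurrent N k z) ^ 2) μ := by
    refine P.integrable_gibbsMeasure (pinnedChain_integrable_mul_gibbsDensity_of_le_pow hω hl.le hβ.le γ N hT 4
      (hjc.pow 2) (C := (N * ((3 + β) / 2)) ^ 2) fun z => ?_)
    rw [abs_pow, show (4:ℕ) = 2 * 2 from rfl, pow_mul, ← mul_pow]
    exact pow_le_pow_left₀ (abs_nonneg _) (hjle z) 2
  have hI2h : Integrable (fun z : PhaseSpace N => (H2 ![z.1 a, z.2 a, z.1 b, z.2 b]) ^ 2) μ := by
    refine P.integrable_gibbsMeasure (pinnedChain_integrable_mul_gibbsDensity_of_le_pow hω hl.le hβ.le γ N hT 16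
      (hhc.pow 2) (C := A * (1 + 2 * (1 + 4 / lam) ^ 8 + 2 * 4 ^ 8)) fun z => ?_)
    rw [abs_of_nonneg (sq_nonneg _)]
    exact pinnedChain_twoSite_sq_le hω.le hl hβ.le γ N hA hHb a b z
  have hIjh : Integrable (fun z : PhaseSpace N => P.bondCurrent N k z * H2 ![z.1 a, z.2 a, z.1 b, z.2 b]) μ := by
    refine P.integrable_gibbsMeasure (pinnedChain_integrable_mul_gibbsDensity_of_le_pow hω hl.le hβ.le γ N hT
      (2 + 8) (hjc.mul hhc) (C := N * ((3 + β) / 2) * Kh) fun z => ?_)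
    rw [abs_mul]
    have hH0 := pinnedChain_hamiltonian_nonneg hω.le hl.le hβ.le γ N z
    calc |P.bondCurrent N k z| * |H2 ![z.1 a, z.2 a, z.1 b, z.2 b]|
        ≤ (N * ((3 + β) / 2) * (1 + P.hamiltonian N z) ^ 2) * (Kh * (1 + P.hamiltonian N z) ^ 8) :=
          mul_le_mul (hjle z) (pinnedChain_abs_twoSite_le hω.le hl hβ.le γ N hA hHb a b z) (abs_nonneg _)
            (by positivity)
      _ = _ := by ring
  have hcs := sq_integral_mul_le μ hI2j hI2h hIjh
  have h1 := pinnedChain_gibbs_sq_bondCurrent_le hω hl hβ γ N hT k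
  have h2 := pinnedChain_gibbs_twoSite_sq_le hω hl hβ.le γ N hT hHc hA hHb a b
  have h1' : 0 ≤ ∫ z, (P.bondCurrent N k z) ^ 2 ∂μ := integral_nonneg fun z => sq_nonneg _
  have h2' : 0 ≤ ∫ z, (H2 ![z.1 a, z.2 a, z.1 b, z.2 b]) ^ 2 ∂μ := integral_nonneg fun z => sq_nonneg _
  rw [← Real.sqrt_sq (abs_nonneg _), sq_abs]
  exact Real.sqrt_le_sqrt (hcs.trans (mul_le_mul h1 h2 h2' (by positivity)))

/-- A `0/1` indicator sum over `Fin N` with at most one index satisfying the predicate is `≤ 1`. [folklore] -/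
theorem sum_boole_le_one {P : Fin N → Prop} [DecidablePred P] (h : ∀ k k', P k → P k' → k = k') :
    (∑ k : Fin N, if P k then (1:ℝ) else 0) ≤ 1 := by
  rw [Finset.sum_boole]
  have : (Finset.univ.filter P).card ≤ 1 :=
    Finset.card_le_one.mpr fun k hk k' hk' => h k k' (by simpa using hk) (by simpa using hk')
  exact_mod_cast this

/-- **Total current against a boundary observable**:
`|E_μ[J_N · H2(z_a,z_b)]| ≤ 4 √(N K₀ B_N)` — only the (at most four) bonds touching `a, b` correlate. [folklore] -/
theorem pinnedChain_gibbs_abs_totalCurrent_mul_twoSite_le (hω : 0 < ω₂) (hl : 0 < lam) (hβ : 0 < β) (γ : ℝ)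
    (N : ℕ) {T : ℝ} (hT : 0 < T) {H2 : (Fin 4 → ℝ) → ℝ} (hHc : Continuous H2) {A : ℝ} (hA : 0 ≤ A)
    (hHb : ∀ u, (H2 u) ^ 2 ≤ A * (1 + u 0 ^ 8 + u 1 ^ 8 + u 2 ^ 8 + u 3 ^ 8)) (a b : Fin N) :
    |∫ z, (∑ k : Fin N, (pinnedChain ω₂ lam β γ).bondCurrent N k z) * H2 ![z.1 a, z.2 a, z.1 b, z.2 b]
        ∂((pinnedChain ω₂ lam β γ).gibbsMeasure N T)| ≤
      4 * Real.sqrt (N * (2 * T ^ 2 + 384 * β ^ 2 * T ^ 3 / (lam * ω₂)) *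
        (A * (1 + 2 * Real.sqrt (585 * T ^ 4 / lam ^ 4 * N) + 210 * T ^ 4))) := by
  set P := pinnedChain ω₂ lam β γ with hP
  set μ := P.gibbsMeasure N T with hμ
  set R : ℝ := Real.sqrt (N * (2 * T ^ 2 + 384 * β ^ 2 * T ^ 3 / (lam * ω₂)) *
        (A * (1 + 2 * Real.sqrt (585 * T ^ 4 / lam ^ 4 * N) + 210 * T ^ 4))) with hR
  have hR0 : 0 ≤ R := Real.sqrt_nonneg _
  set Kh : ℝ := Real.sqrt (A * (1 + 2 * (1 + 4 / lam) ^ 8 + 2 * 4 ^ 8)) with hKh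
  have hhc := continuous_twoSite (N := N) hHc a b
  -- integrability of each `j_k · H2`
  have hIjh : ∀ k : Fin N, Integrable (fun z : PhaseSpace N =>
      P.bondCurrent N k z * H2 ![z.1 a, z.2 a, z.1 b, z.2 b]) μ := by
    intro k
    have hjc : Continuous (P.bondCurrent N k) := pinnedChain_continuous_bondCurrent ω₂ lam β γ N k
    refine P.integrable_gibbsMeasure (pinnedChain_integrable_mul_gibbsDensity_of_le_pow hω hl.le hβ.le γ N hT
      (2 + 8) (hjc.mul hhc) (C := N * ((3 + β) / 2) * Kh) fun z => ?_)
    rw [abs_mul]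
    have hH0 := pinnedChain_hamiltonian_nonneg hω.le hl.le hβ.le γ N z
    have hjle : |P.bondCurrent N k z| ≤ N * ((3 + β) / 2) * (1 + P.hamiltonian N z) ^ 2 := by
      have := pinnedChain_abs_bondCurrent_le hω.le hl.le hβ.le γ N k z
      linarith
    calc |P.bondCurrent N k z| * |H2 ![z.1 a, z.2 a, z.1 b, z.2 b]|
        ≤ (N * ((3 + β) / 2) * (1 + P.hamiltonian N z) ^ 2) * (Kh * (1 + P.hamiltonian N z) ^ 8) :=
          mul_le_mul hjle (pinnedChain_abs_twoSite_le hω.le hl hβ.le γ N hA hHb a b z) (abs_nonneg _)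
            (by positivity)
      _ = _ := by ring
  have hsplit : ∫ z, (∑ k : Fin N, P.bondCurrent N k z) * H2 ![z.1 a, z.2 a, z.1 b, z.2 b] ∂μ =
      ∑ k : Fin N, ∫ z, P.bondCurrent N k z * H2 ![z.1 a, z.2 a, z.1 b, z.2 b] ∂μ := by
    rw [← integral_finsetSum _ fun k _ => hIjh k]
    refine integral_congr_ae (Filter.Eventually.of_forall fun z => ?_)
    simp [Finset.sum_mul]
  rw [hsplit]
  -- each term: bounded by `R` if the bond touches `a` or `b`, else zero
  set touch : Fin N → Prop := fun k => k = a ∨ k = b ∨ k.val + 1 = a.val ∨ k.val + 1 = b.val with htouch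
  have hterm : ∀ k : Fin N, |∫ z, P.bondCurrent N k z * H2 ![z.1 a, z.2 a, z.1 b, z.2 b] ∂μ| ≤
      if touch k then R else 0 := by
    intro k
    by_cases ht : touch k
    · rw [if_pos ht]
      exact pinnedChain_gibbs_abs_bondCurrent_mul_twoSite_le hω hl hβ γ N hT hHc hA hHb a b k
    · rw [if_neg ht]
      simp only [htouch, not_or] at ht
      rw [P.integral_gibbsMeasure, pinnedChain_integral_bondCurrent_mul_twoSite_eq_zero hω hl hβ.le γ N hT
        hHc hA hHb a b k ht.1 ht.2.1 ht.2.2.1 ht.2.2.2]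
      simp
  have hind : ∀ k : Fin N, (if touch k then R else 0) ≤
      R * ((if k = a then 1 else 0) + (if k = b then 1 else 0) + (if k.val + 1 = a.val then 1 else 0) +
        (if k.val + 1 = b.val then 1 else 0)) := by
    intro k
    by_cases ht : touch k
    · rw [if_pos ht]
      rcases ht with h | h | h | h <;> simp [h] <;> split_ifs <;> nlinarith
    · rw [if_neg ht]
      have : 0 ≤ (if k = a then (1:ℝ) else 0) + (if k = b then 1 else 0) + (if k.val + 1 = a.val then 1 else 0) +
          (if k.val + 1 = b.val then 1 else 0) := by positivity
      positivity
  have hca := sum_boole_le_one (N := N) (P := fun k => k = a) (fun k k' h h' => h.trans h'.symm)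
  have hcb := sum_boole_le_one (N := N) (P := fun k => k = b) (fun k k' h h' => h.trans h'.symm)
  have hca' := sum_boole_le_one (N := N) (P := fun k : Fin N => k.val + 1 = a.val)
    (fun k k' h h' => Fin.ext (by omega))
  have hcb' := sum_boole_le_one (N := N) (P := fun k : Fin N => k.val + 1 = b.val)
    (fun k k' h h' => Fin.ext (by omega))
  calc |∑ k : Fin N, ∫ z, P.bondCurrent N k z * H2 ![z.1 a, z.2 a, z.1 b, z.2 b] ∂μ|
      ≤ ∑ k : Fin N, |∫ z, P.bondCurrent N k z * H2 ![z.1 a, z.2 a, z.1 b, z.2 b] ∂μ| :=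
        Finset.abs_sum_le_sum_abs _ _
    _ ≤ ∑ k : Fin N, R * ((if k = a then 1 else 0) + (if k = b then 1 else 0) +
        (if k.val + 1 = a.val then 1 else 0) + (if k.val + 1 = b.val then 1 else 0)) :=
        Finset.sum_le_sum fun k _ => (hterm k).trans (hind k)
    _ = R * ((∑ k : Fin N, if k = a then (1:ℝ) else 0) + (∑ k : Fin N, if k = b then (1:ℝ) else 0) +
        (∑ k : Fin N, if k.val + 1 = a.val then (1:ℝ) else 0) +
        (∑ k : Fin N, if k.val + 1 = b.val then (1:ℝ) else 0)) := by
        rw [← Finset.mul_sum]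
        simp only [Finset.sum_add_distrib]
    _ ≤ R * 4 := by
        refine mul_le_mul_of_nonneg_left ?_ hR0
        linarith
    _ = 4 * R := by ring

end Pinned

end Summit.AtomisticToContinuum.FouriersLaw.Theorems.NoOddCharge

end
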